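import Summits.QuantumAdvantage.QuantumAdvantage.Theorems.LinnikCubicClassGroupsDegreeOnePrimesEscapeConjClassPNTRelativeBounds
import Summits.QuantumAdvantage.QuantumAdvantage.Theorems.LinnikCubicClassGroupsDegreeOnePrimesEscapeConjClassPNTRelativePiLemmas
import HarnessLib

/-!
# The Chebotarev prime number theorem over an arbitrary base in the Linnik range: the `π`-form

Topic `Summits/QuantumAdvantage/QuantumAdvantage/Theorems`, cell B2b-1 (linnik-cubic), PART A (gen 16); helper
toward the crux `DegreeOnePrimesEscape` (stmt-QuantumAdvantage-11543).  HONEST FRAMING: the value of this file is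
a THEOREM (kernel-checked, GRH-free, Siegel-free, no hypothesis) — NOT summit progress.

**Theorem** (`frobeniusClass_PNT_pi_relative`).  For `n > 1` and `0 < ε ≤ 1` there are `L, c > 0` such that for
every tower `ℚ ⊆ F ⊆ N` with `N/F` Galois, `[N:ℚ] = n`, and every `σ ∈ G = Gal(N/F)`, with `δ = |C(σ)|/|G|`,
`d = |d_N|` and `π_C(x) = #{𝔮 ⊂ 𝓞_F prime : N𝔮 = p ≤ x prime, p ∤ d_N, Frob_𝔮 ∈ C(σ)}`, for every `x ≥ d^L`:
(A) if `ζ_N` has no real zero in `(1 − c/(log d + log 4), 1)`: `|π_C(x) − δ Li(x)| ≤ ε δ Li(x)`;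
(B) if `β₁` is such a zero: `|π_C(x) − δ (Li(x) − Li(x^{β₁}))| ≤ ε δ (Li(x) − Li(x^{β₁}))` when
`ζ_{N^{⟨σ⟩}}(β₁) = 0`, and `|π_C(x) − δ (Li(x) + Li(x^{β₁}))| ≤ ε δ (Li(x) + Li(x^{β₁}))` otherwise
(`Li = offsetLogIntegral`).  This is the printed form of [LagariasMontgomeryOdlyzko1979, Thm 1.1 / (1.4)] and
[ThornerZaman2019, Thm 1.4] — `π_C(x, N/F)` for an arbitrary base field `F` — in the Linnik range, with the
degree-one primes of `F` counted (those of degree `≥ 2` number `≤ [F:ℚ] √x` below `x`).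

Proof: the `θ`-form `frobeniusClass_PNT_relative`, the Abel-summation package over the prime ideals of `F`
(`…ConjClassPNTRelativePiLemmas.lean`) and the transfer lemma `division_pi_transfer` of `…DivisionPNTPiLemmas.lean`,
applied to `T/M`, `δ/M` with `M = [F:ℚ](log 4 + 4)/log 4` (so that `T/M ≤ (log 4) t`, `δ/M ≥ 1/(4n)`).
-/

noncomputable section

open scoped NumberField nonZeroDivisors
open Finset Real Ideal NumberField MeasureTheory Set
open Literature.NumberTheory.NumberFields Literature.NumberTheory.LFunctions
  Literature.NumberTheory.LFunctions.NumberField Literature.NumberTheory.LFunctions.AbelianDensity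

namespace Summit.QuantumAdvantage.QuantumAdvantage.Theorems.DegreeOnePrimesEscape

/-- `log 4 + 4 ≤ 4 log 4` (`log 4 = 2 log 2 > 1.386`). -/
theorem log_four_add_four_le : Real.log 4 + 4 ≤ 4 * Real.log 4 := by
  have h : Real.log 4 = 2 * Real.log 2 := by
    rw [show (4 : ℝ) = 2 ^ 2 by norm_num, Real.log_pow]; push_cast; ring
  have := Real.log_two_gt_d9
  rw [h]; linarith

/-- The transfer lemma `division_pi_transfer` after rescaling `T`, `P`, `δ` by a constant `M ≥ 1`
(to absorb the factor `[F:ℚ](log 4 + 4)/log 4` in the Chebyshev bound for `θ_F`). -/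
theorem division_pi_transfer_scaled {T : ℝ → ℝ} {M P δ θ₁ β ε₀ ε y x F W : ℝ} (hM : 1 ≤ M)
    (hδ : 0 < δ) (hδ1 : δ ≤ 1)
    (hθ : |θ₁| ≤ 1) (hβ : 1 / 2 < β) (hβ1 : β ≤ 1) (hε₀ : 0 ≤ ε₀) (hεε : 60 * ε₀ ≤ ε) (hy : 2 ≤ y)
    (hT0 : ∀ t, 2 ≤ t → 0 ≤ T t) (hTB : ∀ t, 2 ≤ t → T t ≤ M * (Real.log 4 * t))
    (hTE : ∀ t, y ≤ t → |T t - δ * (t - θ₁ * t ^ β / β)| ≤ ε₀ * (δ * (t - θ₁ * t ^ β / β)))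
    (hx : 256 ≤ x) (hxy : y ^ 2 ≤ x)
    (hTint : IntervalIntegrable (fun t ↦ T t / (t * Real.log t ^ 2)) volume 2 x)
    (hP : P = T x / Real.log x + ∫ t in (2 : ℝ)..x, T t / (t * Real.log t ^ 2))
    (hF : F = x - θ₁ * x ^ β / β) (hWF : W ≤ F) (hjunk : 288 * Real.sqrt x * Real.log x ≤ ε * (δ / M * W)) :
    |P - δ * (offsetLogIntegral x - θ₁ * offsetLogIntegral (x ^ β))| ≤
      ε * (δ * (offsetLogIntegral x - θ₁ * offsetLogIntegral (x ^ β))) := by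
  have hM0 : 0 < M := by linarith
  set T' : ℝ → ℝ := fun t => T t / M with hT'
  have hT'0 : ∀ t, 2 ≤ t → 0 ≤ T' t := fun t ht => div_nonneg (hT0 t ht) hM0.le
  have hT'B : ∀ t, 2 ≤ t → T' t ≤ Real.log 4 * t := fun t ht => by
    rw [hT', div_le_iff₀ hM0, mul_comm]; exact hTB t ht
  have hT'E : ∀ t, y ≤ t → |T' t - δ / M * (t - θ₁ * t ^ β / β)| ≤ ε₀ * (δ / M * (t - θ₁ * t ^ β / β)) := by
    intro t ht
    have h := hTE t ht
    have e1 : T' t - δ / M * (t - θ₁ * t ^ β / β) = (T t - δ * (t - θ₁ * t ^ β / β)) / M := by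
      rw [hT']; field_simp
    have e2 : ε₀ * (δ / M * (t - θ₁ * t ^ β / β)) = (ε₀ * (δ * (t - θ₁ * t ^ β / β))) / M := by
      field_simp
    rw [e1, e2, abs_div, abs_of_pos hM0]
    exact div_le_div_of_nonneg_right h hM0.le
  have hT'int : IntervalIntegrable (fun t ↦ T' t / (t * Real.log t ^ 2)) volume 2 x := by
    have h := hTint.mul_const M⁻¹
    refine h.congr ?_
    · intro t _
      simp only [hT']
      ring
  have hP' : P / M = T' x / Real.log x + ∫ t in (2 : ℝ)..x, T' t / (t * Real.log t ^ 2) := by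
    have hI : ∫ t in (2 : ℝ)..x, T' t / (t * Real.log t ^ 2) =
        (∫ t in (2 : ℝ)..x, T t / (t * Real.log t ^ 2)) / M := by
      rw [← intervalIntegral.integral_div]
      exact intervalIntegral.integral_congr fun t _ => by simp only [hT']; ring
    rw [hI, hP, hT']
    field_simp
  have hδ' : 0 < δ / M := div_pos hδ hM0
  have hδ'1 : δ / M ≤ 1 := by rw [div_le_one hM0]; linarith
  have hmain := division_pi_transfer (T := T') (P := P / M) (δ := δ / M) hδ' hδ'1 hθ hβ hβ1 hε₀ hεε hy hT'0 hT'B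
    hT'E hx hxy hT'int hP' hF hWF hjunk
  set G : ℝ := offsetLogIntegral x - θ₁ * offsetLogIntegral (x ^ β) with hG
  have e1 : P / M - δ / M * G = (P - δ * G) / M := by field_simp
  have e2 : ε * (δ / M * G) = (ε * (δ * G)) / M := by field_simp
  rw [e1, e2, abs_div, abs_of_pos hM0, div_le_div_iff_of_pos_right hM0] at hmain
  exact hmain

variable {F N : Type} [Field F] [NumberField F] [Field N] [NumberField N] [Algebra F N]

omit [NumberField F] [NumberField N] in
/-- `δ · [N:F] ≥ 1` for the density `δ = |C(σ)|/|Gal(N/F)|`. -/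
theorem one_le_classDensity_mul_card [FiniteDimensional F N] [IsGalois F N] (σ : N ≃ₐ[F] N) :
    1 ≤ (Nat.card {τ : N ≃ₐ[F] N // IsConj σ τ} : ℝ) / Nat.card (N ≃ₐ[F] N) * Module.finrank F N := by
  classical
  have hG : (0 : ℝ) < Nat.card (N ≃ₐ[F] N) := by exact_mod_cast Nat.card_pos
  have h1 : (1 : ℝ) ≤ Nat.card {τ : N ≃ₐ[F] N // IsConj σ τ} := by
    haveI : Nonempty {τ : N ≃ₐ[F] N // IsConj σ τ} := ⟨⟨σ, IsConj.refl σ⟩⟩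
    exact_mod_cast Nat.one_le_iff_ne_zero.mpr Nat.card_pos.ne'
  rw [← IsGalois.card_aut_eq_finrank F N, div_mul_cancel₀ _ hG.ne']
  exact h1

set_option maxHeartbeats 4000000 in
open scoped Classical in
/-- **The Chebotarev prime number theorem for a conjugacy class of `Gal(N/F)` in the Linnik range, ARBITRARY BASE,
`π`-form with relative error `ε`** (see the module docstring; `δ = |C(σ)|/|G|`,
`π_C(x) = #{𝔮 : N𝔮 = p ≤ x prime, p ∤ d_N, Frob_𝔮 ∈ C(σ)}`, `Li = offsetLogIntegral`, `d = |d_N|`).  Unconditional.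
[cite: LagariasMontgomeryOdlyzko1979, Theorem 1.1] [cite: ThornerZaman2019, Theorem 1.4] -/
theorem frobeniusClass_PNT_pi_relative (n : ℕ) (hn : 1 < n) {ε : ℝ} (hε : 0 < ε) (hε1 : ε ≤ 1) :
    ∃ L c : ℝ, 0 < L ∧ 0 < c ∧ c ≤ 1 / 4 ∧ ∀ (F N : Type) [Field F] [NumberField F] [Field N] [NumberField N]
      [Algebra F N] [IsGalois F N], Module.finrank ℚ N = n → ∀ σ : N ≃ₐ[F] N,
        ((¬ ∃ β₁ : ℝ, dedekindZeta₁ N β₁ = 0 ∧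
            1 - c / (Real.log ((NumberField.discr N).natAbs : ℝ) + Real.log 4) < β₁ ∧ β₁ < 1) →
          ∀ x : ℝ, ((NumberField.discr N).natAbs : ℝ) ^ L ≤ x →
            |((((finite_primeIdealsLE F x).toFinset.filter
                (fun q : Ideal (𝓞 F) => (Ideal.absNorm q).Prime ∧ ¬ ((Ideal.absNorm q : ℤ) ∣ NumberField.discr N) ∧
                  ∃ (Q : Ideal (𝓞 N)) (_ : Q.IsMaximal) (_ : Q.LiesOver q) (φ g : N ≃ₐ[F] N),
                    IsArithFrobAt (𝓞 F) φ Q ∧ Q.inertia (N ≃ₐ[F] N) = ⊥ ∧ g * φ * g⁻¹ = σ)).card : ℕ) : ℝ) -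
              (Nat.card {τ : N ≃ₐ[F] N // IsConj σ τ} : ℝ) / Nat.card (N ≃ₐ[F] N) *
                offsetLogIntegral x| ≤
              ε * ((Nat.card {τ : N ≃ₐ[F] N // IsConj σ τ} : ℝ) / Nat.card (N ≃ₐ[F] N) *
                offsetLogIntegral x)) ∧
        (∀ β₁ : ℝ, dedekindZeta₁ N β₁ = 0 →
          1 - c / (Real.log ((NumberField.discr N).natAbs : ℝ) + Real.log 4) < β₁ → β₁ < 1 →
          (dedekindZeta₁ (IntermediateField.fixedField (Subgroup.zpowers σ)) β₁ = 0 →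
            ∀ x : ℝ, ((NumberField.discr N).natAbs : ℝ) ^ L ≤ x →
              |((((finite_primeIdealsLE F x).toFinset.filter
                  (fun q : Ideal (𝓞 F) => (Ideal.absNorm q).Prime ∧ ¬ ((Ideal.absNorm q : ℤ) ∣ NumberField.discr N) ∧
                    ∃ (Q : Ideal (𝓞 N)) (_ : Q.IsMaximal) (_ : Q.LiesOver q) (φ g : N ≃ₐ[F] N),
                      IsArithFrobAt (𝓞 F) φ Q ∧ Q.inertia (N ≃ₐ[F] N) = ⊥ ∧ g * φ * g⁻¹ = σ)).card : ℕ) : ℝ) -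
                (Nat.card {τ : N ≃ₐ[F] N // IsConj σ τ} : ℝ) / Nat.card (N ≃ₐ[F] N) *
                  (offsetLogIntegral x - offsetLogIntegral (x ^ β₁))| ≤
                ε * ((Nat.card {τ : N ≃ₐ[F] N // IsConj σ τ} : ℝ) / Nat.card (N ≃ₐ[F] N) *
                  (offsetLogIntegral x - offsetLogIntegral (x ^ β₁)))) ∧
          (dedekindZeta₁ (IntermediateField.fixedField (Subgroup.zpowers σ)) β₁ ≠ 0 →
            ∀ x : ℝ, ((NumberField.discr N).natAbs : ℝ) ^ L ≤ x →
              |((((finite_primeIdealsLE F x).toFinset.filter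
                  (fun q : Ideal (𝓞 F) => (Ideal.absNorm q).Prime ∧ ¬ ((Ideal.absNorm q : ℤ) ∣ NumberField.discr N) ∧
                    ∃ (Q : Ideal (𝓞 N)) (_ : Q.IsMaximal) (_ : Q.LiesOver q) (φ g : N ≃ₐ[F] N),
                      IsArithFrobAt (𝓞 F) φ Q ∧ Q.inertia (N ≃ₐ[F] N) = ⊥ ∧ g * φ * g⁻¹ = σ)).card : ℕ) : ℝ) -
                (Nat.card {τ : N ≃ₐ[F] N // IsConj σ τ} : ℝ) / Nat.card (N ≃ₐ[F] N) *
                  (offsetLogIntegral x + offsetLogIntegral (x ^ β₁))| ≤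
                ε * ((Nat.card {τ : N ≃ₐ[F] N // IsConj σ τ} : ℝ) / Nat.card (N ≃ₐ[F] N) *
                  (offsetLogIntegral x + offsetLogIntegral (x ^ β₁))))) := by
  have hn0 : (0 : ℝ) < n := by exact_mod_cast (lt_trans Nat.zero_lt_one hn)
  have hn1 : (1 : ℝ) ≤ n := by exact_mod_cast hn.le
  set ε₀ : ℝ := ε / 60 with hε₀
  have hε₀0 : 0 < ε₀ := by positivity
  have hε₀1 : ε₀ ≤ 1 := by rw [hε₀]; linarith
  obtain ⟨L₀, c, hL₀, hc, hc4, h⟩ := frobeniusClass_PNT_relative n hn hε₀0 hε₀1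
  obtain ⟨c₁, hc₁, hc₁1, hMT⟩ := exceptional_mainTerm_ge' n hn
  set e : ℝ := (1 : ℝ) + n * n with he
  set L₁ : ℝ := max L₀ 1 with hL₁
  set K : ℝ := 18432 * n / (ε * c₁) with hK
  have hK1 : 1 ≤ K := by
    rw [hK, le_div_iff₀ (by positivity)]; nlinarith [mul_le_mul hε1 hc₁1 hc₁.le zero_le_one]
  obtain ⟨L, hL, hthr⟩ := pi_thresholds (2 * L₁) e hK1
  refine ⟨L, c, hL, hc, hc4, fun F N _ _ _ _ _ _ hN σ => ?_⟩
  obtain ⟨hA, hB⟩ := h F N hN σ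
  -- sizes depending on `F`, `N`, `σ`
  have hN1 : 1 < Module.finrank ℚ N := by rw [hN]; exact hn
  set d : ℝ := ((NumberField.discr N).natAbs : ℝ) with hd
  have hd3 : (3 : ℝ) ≤ d := three_le_natAbs_discr_real N hN1
  obtain ⟨hd0, hd1⟩ : (0 : ℝ) < d ∧ (1 : ℝ) ≤ d := ⟨by linarith, by linarith⟩
  obtain ⟨hδ0, hδ1⟩ := classDensity_pos_le_one_rel σ
  set δ : ℝ := (Nat.card {τ : N ≃ₐ[F] N // IsConj σ τ} : ℝ) / Nat.card (N ≃ₐ[F] N) with hδ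
  -- the scaling constant `M = [F:ℚ](log 4 + 4)/log 4`
  haveI : FiniteDimensional F N := Module.Finite.of_restrictScalars_finite ℚ F N
  set nF : ℝ := (Module.finrank ℚ F : ℝ) with hnF
  have hnF1 : 1 ≤ nF := by rw [hnF]; exact_mod_cast Module.finrank_pos
  have hlog4 : 0 < Real.log 4 := Real.log_pos (by norm_num)
  set M : ℝ := nF * (Real.log 4 + 4) / Real.log 4 with hM
  have hM1 : 1 ≤ M := by
    rw [hM, le_div_iff₀ hlog4]; nlinarith
  have hM0 : 0 < M := by linarith
  have hM4 : M ≤ 4 * nF := by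
    rw [hM, div_le_iff₀ hlog4]
    have := log_four_add_four_le
    nlinarith
  -- `δ/M ≥ 1/(4n)`: `δ [N:F] ≥ 1`, `[F:ℚ][N:F] = n`, `M ≤ 4[F:ℚ]`
  have hdeg : nF * (Module.finrank F N : ℝ) = n := by
    rw [hnF, ← hN, ← Module.finrank_mul_finrank ℚ F N]; push_cast; ring
  have hδM : 1 ≤ δ / M * (4 * n) := by
    have h1 : 1 ≤ δ * (Module.finrank F N : ℝ) := one_le_classDensity_mul_card σ
    have hm0 : (0 : ℝ) ≤ Module.finrank F N := Nat.cast_nonneg _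
    rw [div_mul_eq_mul_div, le_div_iff₀ hM0, ← hdeg, one_mul]
    calc M ≤ 4 * nF := hM4
      _ = 4 * nF * 1 := by ring
      _ ≤ 4 * nF * (δ * (Module.finrank F N : ℝ)) := mul_le_mul_of_nonneg_left h1 (by positivity)
      _ = δ * (4 * (nF * (Module.finrank F N : ℝ))) := by ring
  set Pgood : Ideal (𝓞 F) → Prop := fun q => (Ideal.absNorm q).Prime ∧ ¬ ((Ideal.absNorm q : ℤ) ∣ NumberField.discr N) ∧
      ∃ (Q : Ideal (𝓞 N)) (_ : Q.IsMaximal) (_ : Q.LiesOver q) (φ g : N ≃ₐ[F] N),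
        IsArithFrobAt (𝓞 F) φ Q ∧ Q.inertia (N ≃ₐ[F] N) = ⊥ ∧ g * φ * g⁻¹ = σ with hPgood
  set T : ℝ → ℝ := fun t => ∑ q ∈ (finite_primeIdealsLE F t).toFinset with Pgood q, Real.log (Ideal.absNorm q : ℝ)
    with hT
  -- the common data at `x ≥ d^L`
  set y : ℝ := d ^ L₁ with hy
  have hy2 : 2 ≤ y := le_trans (by linarith : (2 : ℝ) ≤ d) (by
    have := Real.rpow_le_rpow_of_exponent_le hd1 (le_max_right L₀ 1); rwa [Real.rpow_one] at this)
  have hyL₀ : d ^ L₀ ≤ y := Real.rpow_le_rpow_of_exponent_le hd1 (le_max_left _ _)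
  have hT0 : ∀ t, 2 ≤ t → 0 ≤ T t := fun t ht => (sum_filter_primeIdealsLE_log_le Pgood (by linarith)).1
  have hTB : ∀ t, 2 ≤ t → T t ≤ M * (Real.log 4 * t) := by
    intro t ht
    have h1 := (sum_filter_primeIdealsLE_log_le (F := F) Pgood (by linarith : (0 : ℝ) ≤ t)).2
    have e1 : M * (Real.log 4 * t) = nF * (Real.log 4 + 4) * t := by
      rw [hM]; field_simp
    rw [e1]; exact h1
  have key : ∀ x : ℝ, d ^ L ≤ x → 256 ≤ x ∧ y ^ 2 ≤ x ∧ 1 < x ∧ 16 ≤ Real.log x ∧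
      288 * Real.sqrt x * Real.log x ≤ ε * (δ / M * (x * c₁ / (4 * d ^ (2 * e)))) ∧
      IntervalIntegrable (fun t ↦ T t / (t * Real.log t ^ 2)) volume 2 x ∧
      ((((finite_primeIdealsLE F x).toFinset.filter Pgood).card : ℕ) : ℝ) =
        T x / Real.log x + ∫ t in (2 : ℝ)..x, T t / (t * Real.log t ^ 2) := by
    intro x hx
    obtain ⟨hx256, hxL', hx16, hKx⟩ := hthr d hd3 x hx
    have hx2 : (2 : ℝ) ≤ x := by linarith
    have hyy : y ^ 2 ≤ x := by
      rw [hy, ← Real.rpow_natCast, ← Real.rpow_mul hd0.le]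
      have : L₁ * ((2 : ℕ) : ℝ) = 2 * L₁ := by push_cast; ring
      rw [this]; exact hxL'
    refine ⟨hx256, hyy, by linarith, hx16, ?_, intervalIntegrable_sum_filter_primeIdealsLE_log_div Pgood hx2,
      card_filter_primeIdealsLE_eq_div_log_add_integral Pgood hx2⟩
    -- `288 √x log x ≤ ε (δ/M) x c₁/(4 d^{2e})` from `K d^{2e} log x ≤ 4 √x`, `K = 18432 n/(ε c₁)`, `δ/M ≥ 1/(4n)`
    have hx0 : 0 < x := by linarith
    have hsx : Real.sqrt x * Real.sqrt x = x := Real.mul_self_sqrt hx0.le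
    have hD0 : 0 < d ^ (2 * e) := Real.rpow_pos_of_pos hd0 _
    have hK' : 18432 * n * d ^ (2 * e) * Real.log x ≤ 4 * Real.sqrt x * (ε * c₁) := by
      have := hKx
      rw [hK] at this
      have h2 : 18432 * (n : ℝ) / (ε * c₁) * d ^ (2 * e) * Real.log x =
          (18432 * n * d ^ (2 * e) * Real.log x) / (ε * c₁) := by ring
      rw [h2, div_le_iff₀ (by positivity)] at this
      exact this
    rw [show ε * (δ / M * (x * c₁ / (4 * d ^ (2 * e)))) = (ε * c₁ * (δ / M) * x) / (4 * d ^ (2 * e)) by ring,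
      le_div_iff₀ (by positivity)]
    set R₀ : ℝ := 1152 * d ^ (2 * e) * Real.sqrt x * Real.log x with hR₀
    have hR₀0 : 0 ≤ R₀ := by
      have : 0 ≤ Real.log x := by linarith
      positivity
    have hA' : 4 * (n : ℝ) * R₀ ≤ ε * c₁ * x := by
      have h1 := mul_le_mul_of_nonneg_right hK' (Real.sqrt_nonneg x)
      have e1 : 18432 * (n : ℝ) * d ^ (2 * e) * Real.log x * Real.sqrt x = 4 * (4 * n * R₀) := by rw [hR₀]; ring
      have e2 : 4 * Real.sqrt x * (ε * c₁) * Real.sqrt x = 4 * (ε * c₁ * x) := by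
        linear_combination (4 * (ε * c₁)) * hsx
      rw [e1, e2] at h1
      linarith
    have hB' : R₀ ≤ δ / M * (4 * n) * R₀ := le_mul_of_one_le_left hR₀0 hδM
    have hC' : δ / M * (4 * n) * R₀ ≤ δ / M * (ε * c₁ * x) := by
      rw [mul_assoc]; exact mul_le_mul_of_nonneg_left hA' (div_nonneg hδ0.le hM0.le)
    have e3 : 288 * Real.sqrt x * Real.log x * (4 * d ^ (2 * e)) = R₀ := by rw [hR₀]; ring
    rw [e3]
    linarith
  refine ⟨?_, ?_⟩
  · -- (A): `θ₁ = 0`, `β = 1`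
    intro hexc x hx
    obtain ⟨hx256, hyy, hx1, hx16, hjunk, hTint, hP⟩ := key x hx
    have hTE : ∀ t, y ≤ t → |T t - δ * (t - 0 * t ^ (1 : ℝ) / 1)| ≤ ε₀ * (δ * (t - 0 * t ^ (1 : ℝ) / 1)) := by
      intro t ht
      have := hA hexc t (hyL₀.trans ht)
      simp only [zero_mul, zero_div, sub_zero]
      exact this
    have hmain := division_pi_transfer_scaled (θ₁ := 0) (β := 1) (F := x - 0 * x ^ (1 : ℝ) / 1)
      (W := x * c₁ / (4 * d ^ (2 * e))) hM1
      hδ0 hδ1 (by norm_num) (by norm_num) le_rfl hε₀0.le (by rw [hε₀]; linarith) hy2 hT0 hTB hTE hx256 hyy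
      hTint hP rfl ?_ hjunk
    · simpa only [zero_mul, sub_zero] using hmain
    · simp only [zero_mul, zero_div, sub_zero]
      have hx0 : 0 < x := by linarith
      have hD1 : 1 ≤ d ^ (2 * e) := Real.one_le_rpow hd1 (by positivity)
      rw [div_le_iff₀ (by positivity)]
      nlinarith [mul_le_mul_of_nonneg_left hD1 hx0.le]
  · -- (B)
    intro β₁ hζ₁ hβ₁c hβ₁1
    obtain ⟨hB1, hB2⟩ := hB β₁ hζ₁ hβ₁c hβ₁1
    have hβ34 : 3 / 4 ≤ β₁ := three_quarters_le_of_window hc hc4 hd3 hβ₁c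
    have hβhalf : 1 / 2 < β₁ := by linarith
    refine ⟨?_, ?_⟩
    · -- (B1): `θ₁ = 1`
      intro hζσ x hx
      obtain ⟨hx256, hyy, hx1, hx16, hjunk, hTint, hP⟩ := key x hx
      have hTE : ∀ t, y ≤ t → |T t - δ * (t - 1 * t ^ β₁ / β₁)| ≤ ε₀ * (δ * (t - 1 * t ^ β₁ / β₁)) := by
        intro t ht
        have := (hB1 hζσ t (hyL₀.trans ht)).2
        simp only [one_mul]
        exact this
      have hW : x * c₁ / (4 * d ^ (2 * e)) ≤ x - 1 * x ^ β₁ / β₁ := by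
        rw [one_mul]; exact hMT N hN β₁ hζ₁ hβ34 hβ₁1 x hx1 hx16
      have hmain := division_pi_transfer_scaled (θ₁ := 1) (β := β₁) hM1 hδ0 hδ1 (by norm_num) hβhalf hβ₁1.le
        hε₀0.le (by rw [hε₀]; linarith) hy2 hT0 hTB hTE hx256 hyy hTint hP rfl hW hjunk
      simpa only [one_mul] using hmain
    · -- (B2): `θ₁ = −1`
      intro hζσ x hx
      obtain ⟨hx256, hyy, hx1, hx16, hjunk, hTint, hP⟩ := key x hx
      have hx0 : 0 < x := by linarith
      have hβ0 : 0 < β₁ := by linarith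
      have hTE : ∀ t, y ≤ t → |T t - δ * (t - (-1) * t ^ β₁ / β₁)| ≤ ε₀ * (δ * (t - (-1) * t ^ β₁ / β₁)) := by
        intro t ht
        have := hB2 hζσ t (hyL₀.trans ht)
        simp only [neg_one_mul, neg_div, sub_neg_eq_add]
        exact this
      have hW : x * c₁ / (4 * d ^ (2 * e)) ≤ x - (-1) * x ^ β₁ / β₁ := by
        rw [neg_one_mul, neg_div, sub_neg_eq_add]
        have hy0 : 0 ≤ x ^ β₁ / β₁ := div_nonneg (Real.rpow_nonneg hx0.le _) hβ0.le
        have hD1 : 1 ≤ d ^ (2 * e) := Real.one_le_rpow hd1 (by positivity)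
        rw [div_le_iff₀ (by positivity)]
        nlinarith [mul_le_mul_of_nonneg_left hD1 hx0.le]
      have hmain := division_pi_transfer_scaled (θ₁ := -1) (β := β₁) hM1 hδ0 hδ1 (by norm_num) hβhalf hβ₁1.le
        hε₀0.le (by rw [hε₀]; linarith) hy2 hT0 hTB hTE hx256 hyy hTint hP rfl hW hjunk
      simpa only [neg_one_mul, sub_neg_eq_add] using hmain

end Summit.QuantumAdvantage.QuantumAdvantage.Theorems.DegreeOnePrimesEscape

end
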